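import Literature.NumberTheory.Automorphic.GL2CESHFamily
import Literature.NumberTheory.Automorphic.GL2CPrimitiveSmooth
import Literature.NumberTheory.Automorphic.GL2CCoeffRepGrowth
import Literature.NumberTheory.Automorphic.GL2CAutomorphicEvalSmooth
import Literature.NumberTheory.Automorphic.AutomorphicLieDerivSkewAdjointArchGrowth
import Literature.NumberTheory.Automorphic.AutomorphicTwistNorm
import Literature.NumberTheory.Automorphic.IdeleNormDetGL
import Literature.NumberTheory.Automorphic.AutomorphicFormsSpan
import HarnessLib

/-!
# The untwisted primitive `Ψ` of the Eichler–Shimura–Harder family on `GL₂(𝔸_K)`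

Let `D : GL2CESH.FamilyData K hcpt` (`GL2CESHFamilyDeriv`) and suppose the van Est class of the
family has an automorphic primitive in the sense of
`GL2C.exists_automorphic_primitive_of_vanEstClass_eq_zero`: constants `m : 𝒢 ⧸ L → E_λ(ℂ)` with
`E(γ)(F_{γ⁻¹ q}((σ₀γ)⁻¹ g) − m(γ⁻¹ q)) = F_q(g) − m(q)` (`PrimRel`), where
`F_q = primitive (family q.out)`.  Following Harder and Borel–Wallach we form the `E_λ(ℂ)`-valued
function on `GL₂(𝔸_K)`

  `Ψ(x) = E(x_∞)⁻¹ (F_{x_f L}(x_∞) − m(x_f L))`   (`Psi`),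

and prove: `Ψ` is left `GL₂(K)`-invariant (`Psi_map_algebraMap_mul`); `A_G` acts on it by the
character `a ↦ a^{−κ}`, `κ = ∑_τ (2λ_{τ,1} + (λ_{τ,0} − λ_{τ,1}))` (`Psi_posRealScalar_mul`,
`centralExp`), so that its coordinates twisted by a Hecke character `χ ∘ det` with
`χ(det a) = a^{κ}` descend to the automorphic quotient (`mulChar_coordFun_invariant`); each
coordinate is continuous, smooth in the archimedean variable and of moderate growth in the
archimedean height locally uniformly in the finite variable (`continuous_coordFun`,
`isArchSmooth_coordFun`, `coordFun_twist_archModerateGrowth` — from `GL2CPrimitiveSmooth`,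
`GL2CCoeffRepGrowth`, `GL2C.norm_primitive_le`, the moderate growth of automorphic forms and
`|det x|_𝔸^{±1} ≤ 2^{[K:ℚ]} (1 ⊔ ‖x‖)^{2[K:ℚ]}`); and its right derivative along `x_i ∈ 𝔭₀` is
`X_i Ψ = Θ(η(x_i)) − ρ_E(x_i) Ψ` in coordinates (`hasDerivAt_Psi_pt_mul_expGL`, `lieDeriv_coordFun`).  These are the hypotheses of Borel's integration by parts
(`AutomorphicLieDerivSkewAdjointArchGrowth`) used in `GL2CESHNonvanishing`.
[cite: Harder1987, §3.1] [cite: BorelWallach2000, VII §2.2 and XIV 2.3] [cite: Borel1997, 11.12]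

Definitions with bodies (`centralExp`, `prim`, `Psi`, `PrimRel`, `arr`, `coordFun`, `coordLM`,
`finHeight`) and theorems; no named fact.
-/

noncomputable section

-- Mathlib idiom (Mathlib/Algebra/Lie/OfAssociative.lean), as in `GL2CCuspFormOps`.
attribute [local instance 100] LieRing.ofAssociativeRing

open scoped Matrix ComplexConjugate MatrixGroups Topology Matrix.Norms.Operator ContDiff BigOperators NNReal
open Complex Filter Finset

namespace Literature.NumberTheory.Automorphic

namespace GL2CESH

namespace FamilyData

open scoped Classical
open _root_.NumberField _root_.NumberField.InfinitePlace _root_.NumberField.mixedEmbedding IsDedekindDomain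
open RealMatrixGroup ComplexPlace ImaginaryQuadratic GL2CCoeff GL2CAut GL2CKType GL2CCuspForm GL2C
open AutomorphicRepData GLnComplexCasimir GL2ComplexCasimir GL2CESHMat Matrix ResGLnCohomology GLnCohomology
open Literature.NumberTheory.DiophantineGeometry Literature.NumberTheory.GaloisRepresentations

variable {K : Type} [Field K] [NumberField K] [IsTotallyComplex K] {hcpt : isCompact_glFiniteIntegralLevel 2 K}
  (D : FamilyData K hcpt)

omit [NumberField K] in
/-- Every `γ ∈ GL₂(K)` is totally positive: `K` totally complex has no real embedding. [folklore] -/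
theorem mem_glTotPos (γ : GL (Fin 2) K) : γ ∈ glTotPos 2 K := by
  rw [glTotPos, Subgroup.mem_iInf]
  intro τ
  exact (IsTotallyComplex.complexEmbedding_not_isReal (K := K) (Complex.ofRealHom.comp τ)
    (by rw [ComplexEmbedding.isReal_iff]; ext y; simp)).elim

/-! ### The primitive of the family and the function `Ψ` -/

/-- The central exponent `κ = ∑_τ (2 λ_{τ,1} + deg_τ)` of `E_λ(ℂ)` on real scalars. [folklore] -/
def centralExp (lam : (K →+* ℂ) → Fin 2 → ℤ) : ℤ := ∑ τ, (2 * lowestEntry (lam τ) + (coeffDegree (lam τ) : ℤ))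

/-- `F_q(g) = primitive (family q.out) g`. [cite: Harder1987, §3.1] -/
def prim (q : BigHeckeGLn.FiniteAdelicGL 2 K ⧸ ResGLnCohomology.level 2 K D.𝔫) (g : GL (Fin 2) ℂ) :
    ResGLnCohomology.CoeffModule ℂ 2 K D.lam :=
  GL2C.primitive (D.family q.out) (g : Mat)

/-- **The untwisted primitive** `Ψ(x) = E(x_∞)⁻¹ (F_{x_f L}(x_∞) − m(x_f L))`.
[cite: Harder1987, §3.1] [cite: BorelWallach2000, VII §2.2] -/
def Psi (m : BigHeckeGLn.FiniteAdelicGL 2 K ⧸ ResGLnCohomology.level 2 K D.𝔫 → ResGLnCohomology.CoeffModule ℂ 2 K D.lam)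
    (x : GL (Fin 2) (AdeleRing (𝓞 K) K)) : ResGLnCohomology.CoeffModule ℂ 2 K D.lam :=
  coeffRepC K D.lam (toComplexGL K 2 x)⁻¹
    (D.prim (QuotientGroup.mk (GLn.sndHom 2 K x)) (toComplexGL K 2 x) - m (QuotientGroup.mk (GLn.sndHom 2 K x)))

/-- **The automorphy relation of the primitive** (the output of
`GL2C.exists_automorphic_primitive_of_vanEstClass_eq_zero`). [cite: BorelWallach2000, VII §2.2] -/
def PrimRel (m : BigHeckeGLn.FiniteAdelicGL 2 K ⧸ ResGLnCohomology.level 2 K D.𝔫 → ResGLnCohomology.CoeffModule ℂ 2 K D.lam) : Prop :=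
  ∀ (γ : glTotPos 2 K) (q : BigHeckeGLn.FiniteAdelicGL 2 K ⧸ ResGLnCohomology.level 2 K D.𝔫) (g : GL (Fin 2) ℂ),
    coeffRepPos ℂ 2 K D.lam γ
        (GL2C.primitive (D.family ((diagPos 2 K γ)⁻¹ • q).out)
            (((((ratToComplexGL K 2).comp (glTotPos 2 K).subtype γ)⁻¹ * g : GL (Fin 2) ℂ)) : Mat) -
          m ((diagPos 2 K γ)⁻¹ • q)) =
      GL2C.primitive (D.family q.out) (g : Mat) - m q

variable {D}

/-! ### Left `GL₂(K)`-invariance -/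

/-- **`Ψ(γ x) = Ψ(x)` for `γ ∈ GL₂(K)`.** [cite: Harder1987, §3.1] -/
theorem Psi_map_algebraMap_mul (h2 : Module.finrank ℚ K = 2)
    {m : BigHeckeGLn.FiniteAdelicGL 2 K ⧸ ResGLnCohomology.level 2 K D.𝔫 → ResGLnCohomology.CoeffModule ℂ 2 K D.lam}
    (hm : D.PrimRel m) (γ : GL (Fin 2) K) (x : GL (Fin 2) (AdeleRing (𝓞 K) K)) :
    D.Psi m (Matrix.GeneralLinearGroup.map (algebraMap K (AdeleRing (𝓞 K) K)) γ * x) = D.Psi m x := by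
  have hK : Subsingleton (InfinitePlace K) := subsingleton_infinitePlace K h2
  set γ' : glTotPos 2 K := ⟨γ, mem_glTotPos γ⟩ with hγ'
  set g := toComplexGL K 2 x with hg
  set c := GLn.sndHom 2 K x with hc
  have hto : toComplexGL K 2 (Matrix.GeneralLinearGroup.map (algebraMap K (AdeleRing (𝓞 K) K)) γ * x) =
      ratToComplexGL K 2 γ * g := by rw [map_mul, toComplexGL_map_algebraMap]
  have hsnd : GLn.sndHom 2 K (Matrix.GeneralLinearGroup.map (algebraMap K (AdeleRing (𝓞 K) K)) γ * x) =
      BigHeckeGLn.globalEmbedding 2 K γ * c := by rw [map_mul, sndHom_map_algebraMap]; rfl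
  have hq : (QuotientGroup.mk (BigHeckeGLn.globalEmbedding 2 K γ * c) :
      BigHeckeGLn.FiniteAdelicGL 2 K ⧸ ResGLnCohomology.level 2 K D.𝔫) = diagPos 2 K γ' • QuotientGroup.mk c := rfl
  -- the relation with `γ'`, `q = γ' • [c]`, `g ↦ σ₀γ g`
  have key := hm γ' (diagPos 2 K γ' • QuotientGroup.mk c) (ratToComplexGL K 2 γ * g)
  rw [inv_smul_smul, show ((ratToComplexGL K 2).comp (glTotPos 2 K).subtype γ')⁻¹ * (ratToComplexGL K 2 γ * g) = g by
    rw [MonoidHom.comp_apply, Subgroup.coe_subtype, inv_mul_cancel_left]] at key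
  rw [Psi, Psi, hto, hsnd, hq, prim, prim, ← key, ← coeffRepC_ratToComplexGL_pos K D.lam hK γ', hγ']
  change coeffRepC K D.lam (ratToComplexGL K 2 γ * g)⁻¹ (coeffRepC K D.lam (ratToComplexGL K 2 γ) _) = _
  rw [← Module.End.mul_apply, ← map_mul, _root_.mul_inv_rev, mul_assoc, inv_mul_cancel, mul_one]

/-! ### The action of `A_G` -/

/-- The complex component of `a ∈ A_G` is the scalar matrix `a`. [folklore] -/
theorem toComplexGL_posRealScalar (t : ℝ≥0ˣ) :
    toComplexGL K 2 (posRealScalar 2 K t) =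
      Matrix.GeneralLinearGroup.scalar (Fin 2) (Units.map Complex.ofRealHom.toMonoidHom
        (Units.map NNReal.toRealHom.toMonoidHom t)) := by
  refine Matrix.GeneralLinearGroup.ext fun i j => ?_
  rw [coe_toComplexGL_apply', GLn.coe_toMixed_posRealScalar, Matrix.scalar_apply, Matrix.diagonal_apply]
  change _ = ((Matrix.scalar (Fin 2) _ : Mat) i j)
  rw [Matrix.scalar_apply, Matrix.diagonal_apply]
  split_ifs
  · rw [toComplex_algebraMap]; rfl
  · exact map_zero _

/-- `E(a · 1) = a^{κ} · id` for `a > 0` real. [folklore] -/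
theorem coeffRepC_posRealScalar (h2 : Module.finrank ℚ K = 2) (lam : (K →+* ℂ) → Fin 2 → ℤ) (t : ℝ≥0ˣ) :
    coeffRepC K lam (toComplexGL K 2 (posRealScalar 2 K t)) =
      ((((t : ℝ≥0) : ℝ) : ℂ) ^ centralExp lam) • LinearMap.id := by
  have hK : Subsingleton (InfinitePlace K) := subsingleton_infinitePlace K h2
  rw [toComplexGL_posRealScalar, coeffRepC_scalar]
  congr 1
  have ht : (((t : ℝ≥0) : ℝ) : ℂ) ≠ 0 :=
    Complex.ofReal_ne_zero.2 (NNReal.coe_pos.2 (pos_iff_ne_zero.2 t.ne_zero)).ne'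
  have hval : ((Units.map Complex.ofRealHom.toMonoidHom (Units.map NNReal.toRealHom.toMonoidHom t) : ℂˣ) : ℂ) =
      (((t : ℝ≥0) : ℝ) : ℂ) := rfl
  have hfac : ∀ τ : K →+* ℂ, (embeddingExt τ (ofComplex K (((t : ℝ≥0) : ℝ) : ℂ)) ^ 2) ^ lowestEntry (lam τ) *
      embeddingExt τ (ofComplex K (((t : ℝ≥0) : ℝ) : ℂ)) ^ coeffDegree (lam τ) =
        (((t : ℝ≥0) : ℝ) : ℂ) ^ (2 * lowestEntry (lam τ) + (coeffDegree (lam τ) : ℤ)) := fun τ => by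
    have he : embeddingExt τ (ofComplex K (((t : ℝ≥0) : ℝ) : ℂ)) = (((t : ℝ≥0) : ℝ) : ℂ) := by
      rw [embeddingExt_ofComplex K hK]
      split_ifs
      · rfl
      · exact Complex.conj_ofReal _
    rw [he, zpow_add₀ ht, zpow_mul, zpow_natCast]
    norm_cast
  rw [hval, centralExp, Finset.prod_congr rfl fun τ _ => hfac τ]
  -- `∏ t^{e τ} = t^{∑ e τ}`
  induction (Finset.univ : Finset (K →+* ℂ)) using Finset.induction_on with
  | empty => simp
  | insert a s ha ih => rw [Finset.prod_insert ha, Finset.sum_insert ha, ih, ← zpow_add₀ ht]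

/-- `E(a)⁻¹ = a^{−κ} · id` for `a ∈ A_G`. [folklore] -/
theorem coeffRepC_posRealScalar_inv (h2 : Module.finrank ℚ K = 2) (lam : (K →+* ℂ) → Fin 2 → ℤ) (t : ℝ≥0ˣ) :
    coeffRepC K lam (toComplexGL K 2 (posRealScalar 2 K t))⁻¹ =
      ((((t : ℝ≥0) : ℝ) : ℂ) ^ centralExp lam)⁻¹ • LinearMap.id := by
  have ht : (((t : ℝ≥0) : ℝ) : ℂ) ≠ 0 :=
    Complex.ofReal_ne_zero.2 (NNReal.coe_pos.2 (pos_iff_ne_zero.2 t.ne_zero)).ne'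
  have hc : (((t : ℝ≥0) : ℝ) : ℂ) ^ centralExp lam ≠ 0 := zpow_ne_zero _ ht
  have h := map_mul (coeffRepC K lam) (toComplexGL K 2 (posRealScalar 2 K t))⁻¹ (toComplexGL K 2 (posRealScalar 2 K t))
  rw [inv_mul_cancel, map_one, coeffRepC_posRealScalar h2, ← Module.End.one_eq_id, mul_smul_comm, mul_one] at h
  -- `1 = c • A` gives `A = c⁻¹ • 1`
  have := congrArg (fun B : Module.End ℂ (ResGLnCohomology.CoeffModule ℂ 2 K lam) =>
    ((((t : ℝ≥0) : ℝ) : ℂ) ^ centralExp lam)⁻¹ • B) h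
  simp only [inv_smul_smul₀ hc] at this
  rw [← this]
  rfl

/-- The primitive is invariant under the scalars `A_G`. [folklore] -/
theorem prim_posRealScalar_mul (q : BigHeckeGLn.FiniteAdelicGL 2 K ⧸ ResGLnCohomology.level 2 K D.𝔫) (t : ℝ≥0ˣ)
    (g : GL (Fin 2) ℂ) : D.prim q (toComplexGL K 2 (posRealScalar 2 K t) * g) = D.prim q g := by
  have ht : (((t : ℝ≥0) : ℝ) : ℂ) ≠ 0 :=
    Complex.ofReal_ne_zero.2 (NNReal.coe_pos.2 (pos_iff_ne_zero.2 t.ne_zero)).ne'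
  unfold prim
  rw [Units.val_mul, toComplexGL_posRealScalar]
  have : ((Matrix.GeneralLinearGroup.scalar (Fin 2) (Units.map Complex.ofRealHom.toMonoidHom
      (Units.map NNReal.toRealHom.toMonoidHom t)) : GL (Fin 2) ℂ) : Mat) * (g : Mat) = (((t : ℝ≥0) : ℝ) : ℂ) • (g : Mat) := by
    change Matrix.scalar (Fin 2) (((t : ℝ≥0) : ℝ) : ℂ) * (g : Mat) = _
    rw [Matrix.scalar_apply, ← Matrix.smul_one_eq_diagonal, Matrix.smul_mul, Matrix.one_mul]
  rw [this]
  exact primitive_smul _ (isUnit_det_coe g) ht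

/-- **`Ψ(a x) = a^{−κ} Ψ(x)` for `a ∈ A_G`.** [cite: Harder1987, §3.1] -/
theorem Psi_posRealScalar_mul (h2 : Module.finrank ℚ K = 2)
    (m : BigHeckeGLn.FiniteAdelicGL 2 K ⧸ ResGLnCohomology.level 2 K D.𝔫 → ResGLnCohomology.CoeffModule ℂ 2 K D.lam)
    (t : ℝ≥0ˣ) (x : GL (Fin 2) (AdeleRing (𝓞 K) K)) :
    D.Psi m (posRealScalar 2 K t * x) = ((((t : ℝ≥0) : ℝ) : ℂ) ^ centralExp D.lam)⁻¹ • D.Psi m x := by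
  have hsnd : GLn.sndHom 2 K (posRealScalar 2 K t * x) = GLn.sndHom 2 K x := by
    rw [map_mul, GLn.sndHom_posRealScalar, one_mul]
  rw [Psi, Psi, map_mul, hsnd, prim_posRealScalar_mul, _root_.mul_inv_rev, map_mul, Module.End.mul_apply,
    coeffRepC_posRealScalar_inv h2, LinearMap.smul_apply, LinearMap.id_apply, LinearMap.map_smul]

/-! ### Coordinates and the twist -/

/-- `Ψ` in the coordinate model: `Θ⁻¹ Ψ(x) ∈ Sym^d ⊗ \overline{Sym}^d`. [folklore] -/
def arr (m : BigHeckeGLn.FiniteAdelicGL 2 K ⧸ ResGLnCohomology.level 2 K D.𝔫 → ResGLnCohomology.CoeffModule ℂ 2 K D.lam)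
    (x : GL (Fin 2) (AdeleRing (𝓞 K) K)) : model ℂ D.d := D.Θ.symm (D.Psi m x)

/-- The `(l, m)` coordinate function of `Ψ`. [folklore] -/
def coordFun (m : BigHeckeGLn.FiniteAdelicGL 2 K ⧸ ResGLnCohomology.level 2 K D.𝔫 → ResGLnCohomology.CoeffModule ℂ 2 K D.lam)
    (l mm : ℕ) (x : GL (Fin 2) (AdeleRing (𝓞 K) K)) : ℂ := ((D.arr m x : model ℂ D.d) : ℕ → ℕ → ℂ) l mm

/-- Unfolding. [folklore] -/
theorem coordFun_apply (m : BigHeckeGLn.FiniteAdelicGL 2 K ⧸ ResGLnCohomology.level 2 K D.𝔫 → ResGLnCohomology.CoeffModule ℂ 2 K D.lam)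
    (l mm : ℕ) (x : GL (Fin 2) (AdeleRing (𝓞 K) K)) :
    D.coordFun m l mm x = ((D.Θ.symm (D.Psi m x) : model ℂ D.d) : ℕ → ℕ → ℂ) l mm := rfl

/-- **The twisted coordinates of `Ψ` are invariant under `A_G · GL₂(K)`** when `χ(det a) = a^{κ}` on
`A_G`. [cite: Harder1987, §3.1] [cite: BorelJacquetCorvallis1979, 5.7] -/
theorem mulChar_coordFun_invariant (h2 : Module.finrank ℚ K = 2)
    {m : BigHeckeGLn.FiniteAdelicGL 2 K ⧸ ResGLnCohomology.level 2 K D.𝔫 → ResGLnCohomology.CoeffModule ℂ 2 K D.lam}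
    (hm : D.PrimRel m) {χ : HeckeCharacter K}
    (hχ : ∀ t : ℝ≥0ˣ, ((detTwist 2 χ (posRealScalar 2 K t) : ℂˣ) : ℂ) = (((t : ℝ≥0) : ℝ) : ℂ) ^ centralExp D.lam)
    (l mm : ℕ) :
    ∀ γ ∈ (AdelicGroupData.gl 2 K).quotientSubgroup, ∀ x,
      mulChar (detTwist 2 χ) (D.coordFun m l mm) (γ * x) = mulChar (detTwist 2 χ) (D.coordFun m l mm) x := by
  refine (AdelicGroupData.gl 2 K).leftInvariant_quotientSubgroup ?_ ?_
  · intro γ hγ x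
    have h1 : detTwist 2 χ γ = 1 := detTwist_eq_one_of_mem_arithmeticSubgroup 2 χ hγ
    obtain ⟨γ₀, rfl⟩ := hγ
    have hP : D.Psi m ((AdelicGroupData.gl 2 K).toAdelic γ₀ * x) = D.Psi m x := Psi_map_algebraMap_mul h2 hm γ₀ x
    rw [mulChar_apply, mulChar_apply, map_mul, h1, one_mul, coordFun_apply, coordFun_apply, hP]
  · rintro _ ⟨t, rfl⟩ x
    have ht : (((t : ℝ≥0) : ℝ) : ℂ) ≠ 0 :=
      Complex.ofReal_ne_zero.2 (NNReal.coe_pos.2 (pos_iff_ne_zero.2 t.ne_zero)).ne'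
    have hc : (((t : ℝ≥0) : ℝ) : ℂ) ^ centralExp D.lam ≠ 0 := zpow_ne_zero _ ht
    rw [mulChar_apply, mulChar_apply, map_mul, Units.val_mul, hχ, coordFun_apply, coordFun_apply]
    have hP : ∀ y : (AdelicGroupData.gl 2 K).Adelic, y = posRealScalar 2 K t →
        D.Psi m (y * x) = ((((t : ℝ≥0) : ℝ) : ℂ) ^ centralExp D.lam)⁻¹ • D.Psi m x := by
      rintro _ rfl
      exact Psi_posRealScalar_mul h2 m t x
    rw [hP _ rfl, LinearEquiv.map_smul, Submodule.coe_smul, Pi.smul_apply, Pi.smul_apply, smul_eq_mul]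
    field_simp

/-! ### `Ψ` along `GL₂(ℂ)`: smoothness and continuity -/

/-- `Ψ (pt M c) = E(M⁻¹)(F_{cL}(M) − m(cL))` for `M` invertible. [folklore] -/
theorem Psi_pt (m : BigHeckeGLn.FiniteAdelicGL 2 K ⧸ ResGLnCohomology.level 2 K D.𝔫 → ResGLnCohomology.CoeffModule ℂ 2 K D.lam)
    {M : Mat} (hM : M ∈ GL2C.Inv) (c : BigHeckeGLn.FiniteAdelicGL 2 K) :
    D.Psi m (pt K (toGL M) c) = coeffRepC K D.lam (toGL M⁻¹)
      (GL2C.primitive (D.family (QuotientGroup.mk c : BigHeckeGLn.FiniteAdelicGL 2 K ⧸ ResGLnCohomology.level 2 K D.𝔫).out) M -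
        m (QuotientGroup.mk c)) := by
  rw [Psi, toComplexGL_pt, sndHom_pt, prim, coe_toGL hM, toGL_nonsing_inv hM]

/-- **`M ↦ E(M⁻¹) v(M)` is smooth on `Inv` when `v` is.** [folklore] -/
theorem contDiffOn_coeffRepC_inv_apply (h2 : Module.finrank ℚ K = 2) {lam : (K →+* ℂ) → Fin 2 → ℤ}
    {v : Mat → ResGLnCohomology.CoeffModule ℂ 2 K lam} (hv : ContDiffOn ℝ ∞ v GL2C.Inv) :
    ContDiffOn ℝ ∞ (fun M : Mat => coeffRepC K lam (toGL M⁻¹) (v M)) GL2C.Inv := by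
  have hK : Subsingleton (InfinitePlace K) := subsingleton_infinitePlace K h2
  set b := Module.finBasis ℂ (ResGLnCohomology.CoeffModule ℂ 2 K lam) with hb
  have hfun : (fun M : Mat => coeffRepC K lam (toGL M⁻¹) (v M)) =
      fun M => ∑ i, b.coord i (v M) • coeffRepC K lam (toGL M⁻¹) (b i) := by
    funext M
    conv_lhs => rw [← b.sum_repr (v M)]
    rw [map_sum]; simp only [map_smul]
    rfl
  rw [hfun]
  refine ContDiffOn.sum fun i _ => ContDiffOn.fun_smul ?_ ?_
  · exact (LinearMap.toContinuousLinearMap ((b.coord i).restrictScalars ℝ)).contDiff.comp_contDiffOn hv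
  · refine (contDiffOn_coeffRepC K lam hK (b i)).comp contDiffOn_nonsing_inv fun M hM => ?_
    change IsUnit M⁻¹.det
    rw [Matrix.det_nonsing_inv]
    exact (mem_Inv.1 hM).ringInverse

/-- **`M ↦ Ψ (pt M c)` is smooth on `Inv`.** [cite: Harder1987, §3.1] -/
theorem contDiffOn_Psi_pt (h2 : Module.finrank ℚ K = 2)
    (m : BigHeckeGLn.FiniteAdelicGL 2 K ⧸ ResGLnCohomology.level 2 K D.𝔫 → ResGLnCohomology.CoeffModule ℂ 2 K D.lam)
    (c : BigHeckeGLn.FiniteAdelicGL 2 K) :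
    ContDiffOn ℝ ∞ (fun M : Mat => D.Psi m (pt K (toGL M) c)) GL2C.Inv := by
  have hprim : ContDiffOn ℝ ∞ (fun M : Mat => GL2C.primitive (D.family
      (QuotientGroup.mk c : BigHeckeGLn.FiniteAdelicGL 2 K ⧸ ResGLnCohomology.level 2 K D.𝔫).out) M -
        m (QuotientGroup.mk c)) GL2C.Inv :=
    (contDiffOn_primitive_infty (D.isCochain_family h2 _) fun j => D.contDiffOn_family h2 _ _).sub contDiffOn_const
  exact (contDiffOn_coeffRepC_inv_apply h2 hprim).congr fun M hM => D.Psi_pt m hM c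

/-- The linear functional `u ↦ (Θ⁻¹ u)_{l,m}`. [folklore] -/
def coordLM (l mm : ℕ) : ResGLnCohomology.CoeffModule ℂ 2 K D.lam →ₗ[ℂ] ℂ :=
  ((LinearMap.proj mm).comp (LinearMap.proj l)).comp ((model ℂ D.d).subtype.comp (D.Θ.symm : _ →ₗ[ℂ] model ℂ D.d))

/-- Unfolding. [folklore] -/
theorem coordLM_apply (l mm : ℕ) (u : ResGLnCohomology.CoeffModule ℂ 2 K D.lam) :
    D.coordLM l mm u = ((D.Θ.symm u : model ℂ D.d) : ℕ → ℕ → ℂ) l mm := rfl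

/-- `coordFun = coordLM ∘ Ψ`. [folklore] -/
theorem coordFun_eq (m : BigHeckeGLn.FiniteAdelicGL 2 K ⧸ ResGLnCohomology.level 2 K D.𝔫 → ResGLnCohomology.CoeffModule ℂ 2 K D.lam)
    (l mm : ℕ) : D.coordFun m l mm = fun x => D.coordLM l mm (D.Psi m x) := rfl

/-- **The coordinates of `Ψ` are smooth in the archimedean variable.** [cite: Harder1987, §3.1] -/
theorem isArchSmooth_coordFun (h2 : Module.finrank ℚ K = 2)
    (m : BigHeckeGLn.FiniteAdelicGL 2 K ⧸ ResGLnCohomology.level 2 K D.𝔫 → ResGLnCohomology.CoeffModule ℂ 2 K D.lam)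
    (l mm : ℕ) : IsArchSmooth (AutomorphyDatum.gl 2 K hcpt).ofArch (D.coordFun m l mm) := by
  refine isArchSmooth_of_contDiffOn_complex K h2 fun c => ?_
  rw [coordFun_eq]
  exact (LinearMap.toContinuousLinearMap ((D.coordLM l mm).restrictScalars ℝ)).contDiff.comp_contDiffOn
    (D.contDiffOn_Psi_pt h2 m c)

/-- **The coordinates of `Ψ` are continuous.** [folklore] -/
theorem continuous_coordFun (h2 : Module.finrank ℚ K = 2)
    (m : BigHeckeGLn.FiniteAdelicGL 2 K ⧸ ResGLnCohomology.level 2 K D.𝔫 → ResGLnCohomology.CoeffModule ℂ 2 K D.lam)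
    (l mm : ℕ) : Continuous (D.coordFun m l mm) := by
  -- `coordFun x = F (toComplexGL x) (x_f L)` with `F g q = coordLM (E(g⁻¹)(F_q(g) − m q))`
  set F : GL (Fin 2) ℂ → BigHeckeGLn.FiniteAdelicGL 2 K ⧸ ResGLnCohomology.level 2 K D.𝔫 → ℂ := fun g q =>
    D.coordLM l mm (coeffRepC K D.lam g⁻¹ (D.prim q g - m q)) with hF
  have hco : D.coordFun m l mm = fun x => F (toComplexGL K 2 x) (QuotientGroup.mk (GLn.sndHom 2 K x)) := rfl
  rw [hco]
  refine continuous_of_coset K (L := ResGLnCohomology.level 2 K D.𝔫) ?_ F fun q => ?_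
  · exact Subgroup.isOpen_of_mem_nhds _ (finitePrincipalCongruenceLevel_mem_nhds_one (n := 2) (K := K) D.h𝔫)
  · -- continuity in `g`: through `M ↦ E(M⁻¹)(F_q(M) − m q)` on `Inv`
    have hsm : ContDiffOn ℝ ∞ (fun M : Mat => coeffRepC K D.lam (toGL M⁻¹) (GL2C.primitive (D.family q.out) M - m q)) GL2C.Inv :=
      contDiffOn_coeffRepC_inv_apply h2
        ((contDiffOn_primitive_infty (D.isCochain_family h2 _) fun j => D.contDiffOn_family h2 _ _).sub contDiffOn_const)
    have hcont := hsm.continuousOn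
    have heq : (fun g : GL (Fin 2) ℂ => F g q) = (fun v => D.coordLM l mm v) ∘
        (fun M : Mat => coeffRepC K D.lam (toGL M⁻¹) (GL2C.primitive (D.family q.out) M - m q)) ∘
          fun g : GL (Fin 2) ℂ => (g : Mat) := by
      funext g
      simp only [hF, Function.comp_apply, prim]
      rw [toGL_nonsing_inv (isUnit_det_coe g), toGL_coe]
    rw [heq]
    refine (LinearMap.toContinuousLinearMap ((D.coordLM l mm).restrictScalars ℝ)).continuous.comp ?_
    exact hcont.comp_continuous Units.continuous_val fun g => isUnit_det_coe g

/-! ### Growth: the finite part of the height, forms of moderate growth at `pt M c` -/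

/-- The finite part `∏_v H_v` of the height of `pt M c` depends only on `c`. [cite: BorelJacquetCorvallis1979, §1.2] -/
def finHeight (c : BigHeckeGLn.FiniteAdelicGL 2 K) : ℝ := ∏ᶠ v, (GLn.localHeight 2 K v (GLn.ofFinite 2 K c) : ℝ)

omit [IsTotallyComplex K] in
/-- `1 ≤ ∏_v H_v`. [folklore] -/
theorem one_le_finHeight (c : BigHeckeGLn.FiniteAdelicGL 2 K) : 1 ≤ finHeight (K := K) c :=
  GLn.one_le_finprod_localHeight _

omit [IsTotallyComplex K] in
/-- `c ↦ ∏_v H_v(1, c)` is continuous. [folklore] -/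
theorem continuous_finHeight : Continuous (finHeight (K := K)) :=
  (GLn.continuous_finprod_localHeight (n := 2) (K := K)).comp (GLn.continuous_ofFinite 2 K)

/-- `‖pt M c‖ = H_∞(pt M c) · ∏_v H_v(c)`. [cite: BorelJacquetCorvallis1979, §1.2] -/
theorem adelicHeightGL_pt (M : GL (Fin 2) ℂ) (c : BigHeckeGLn.FiniteAdelicGL 2 K) :
    adelicHeightGL 2 K (pt K M c) = (GLn.archHeight 2 K (pt K M c) : ℝ) * finHeight (K := K) c := by
  unfold adelicHeightGL finHeight
  congr 1
  exact finprod_congr fun v => by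
    rw [GLn.localHeight_eq_of_sndHom_eq (g' := GLn.ofFinite 2 K c) (by rw [sndHom_pt, GLn.sndHom_ofFinite]) v]

/-- `1 ⊔ ‖pt M c‖ ≤ s(M) · ∏_v H_v(c)`. [folklore] -/
theorem one_sup_adelicHeightGL_pt_le {M : Mat} (hM : M ∈ GL2C.Inv) (c : BigHeckeGLn.FiniteAdelicGL 2 K) :
    1 ⊔ adelicHeightGL 2 K (pt K (toGL M) c) ≤ (1 + ‖M‖ + ‖M⁻¹‖) * finHeight (K := K) c := by
  have hs : (1 ⊔ (GLn.archHeight 2 K (pt K (toGL M) c) : ℝ)) ≤ 1 + ‖M‖ + ‖M⁻¹‖ := by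
    have := archHeight_pt_le_size K (toGL M) c
    rwa [coe_toGL hM] at this
  have hP := one_le_finHeight (K := K) c
  have hs1 := one_le_size M
  rw [adelicHeightGL_pt]
  refine sup_le ?_ ?_
  · nlinarith
  · exact mul_le_mul_of_nonneg_right (le_sup_right.trans hs) (zero_le_one.trans hP)

/-- **A function of moderate growth is `O(s(M)^r)` along `M ↦ pt M c`**, with the exponent of its
moderate growth and a constant depending on `c`. [cite: BorelJacquetCorvallis1979, §1.2 and 4.2] -/
theorem exists_bound_pt_of_hasModerateGrowth {φ : (AdelicGroupData.gl 2 K).Adelic → ℂ}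
    (hφ : HasModerateGrowth (AutomorphyDatum.gl 2 K hcpt) φ) :
    ∃ r : ℕ, ∀ c : BigHeckeGLn.FiniteAdelicGL 2 K, ∃ A : ℝ, 0 ≤ A ∧
      ∀ M ∈ GL2C.Inv, ‖φ (pt K (toGL M) c)‖ ≤ A * (1 + ‖M‖ + ‖M⁻¹‖) ^ r := by
  obtain ⟨A, r, hA⟩ := hφ
  rw [AutomorphyDatum.gl_height] at hA
  refine ⟨r, fun c => ⟨max A 0 * finHeight (K := K) c ^ r, by
    have := one_le_finHeight (K := K) c; positivity, fun M hM => ?_⟩⟩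
  have h1 := one_sup_adelicHeightGL_pt_le hM c
  have h0 : 0 ≤ 1 ⊔ adelicHeightGL 2 K (pt K (toGL M) c) := zero_le_one.trans le_sup_left
  calc ‖φ (pt K (toGL M) c)‖ ≤ A * (1 ⊔ adelicHeightGL 2 K (pt K (toGL M) c)) ^ r := hA _
    _ ≤ max A 0 * (1 ⊔ adelicHeightGL 2 K (pt K (toGL M) c)) ^ r :=
        mul_le_mul_of_nonneg_right (le_max_left _ _) (pow_nonneg h0 _)
    _ ≤ max A 0 * ((1 + ‖M‖ + ‖M⁻¹‖) * finHeight (K := K) c) ^ r :=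
        mul_le_mul_of_nonneg_left (pow_le_pow_left₀ h0 h1 r) (le_max_right _ _)
    _ = max A 0 * finHeight (K := K) c ^ r * (1 + ‖M‖ + ‖M⁻¹‖) ^ r := by rw [mul_pow]; ring

/-- Forms in `W` have moderate growth. [cite: BorelJacquetCorvallis1979, 4.2] -/
theorem hasModerateGrowth_of_mem_W (φ : D.π.W) :
    HasModerateGrowth (AutomorphyDatum.gl 2 K hcpt) (φ : (AdelicGroupData.gl 2 K).Adelic → ℂ) :=
  (isAutomorphicForm_of_mem_automorphicForms_gl (D.π.stable.le_automorphicForms φ.2)).moderateGrowth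

/-- **The entries of an element of the model of `W`, read at `pt M c`, are `O(s(M)^r)`** with one
exponent. [folklore] -/
theorem exists_bound_entries (u : model D.π.W D.d) :
    ∃ r : ℕ, ∀ c : BigHeckeGLn.FiniteAdelicGL 2 K, ∃ A : ℝ, 0 ≤ A ∧ ∀ M ∈ GL2C.Inv, ∀ l mm : ℕ,
      ‖(((u : ℕ → ℕ → D.π.W) l mm : D.π.W) : (AdelicGroupData.gl 2 K).Adelic → ℂ) (pt K (toGL M) c)‖ ≤
        A * (1 + ‖M‖ + ‖M⁻¹‖) ^ r := by
  -- one exponent per entry, then the max over the finitely many non-zero entries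
  have hex : ∀ p : ℕ × ℕ, ∃ r : ℕ, ∀ c : BigHeckeGLn.FiniteAdelicGL 2 K, ∃ A : ℝ, 0 ≤ A ∧
      ∀ M ∈ GL2C.Inv, ‖(((u : ℕ → ℕ → D.π.W) p.1 p.2 : D.π.W) : (AdelicGroupData.gl 2 K).Adelic → ℂ) (pt K (toGL M) c)‖ ≤
        A * (1 + ‖M‖ + ‖M⁻¹‖) ^ r := fun p =>
    exists_bound_pt_of_hasModerateGrowth (D.hasModerateGrowth_of_mem_W _)
  choose r hr using hex
  set S : Finset (ℕ × ℕ) := Finset.range (D.d + 1) ×ˢ Finset.range (D.d + 1) with hS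
  refine ⟨S.sup r, fun c => ?_⟩
  choose A hA0 hA using fun p => hr p c
  refine ⟨∑ p ∈ S, A p, Finset.sum_nonneg fun p _ => hA0 p, fun M hM l mm => ?_⟩
  have hs1 := one_le_size M
  by_cases hl : D.d < l
  · rw [(u : model D.π.W D.d).2 l mm (Or.inl hl), Submodule.coe_zero]
    change ‖(0 : ℂ)‖ ≤ _
    rw [norm_zero]
    exact mul_nonneg (Finset.sum_nonneg fun p _ => hA0 p) (pow_nonneg (by positivity) _)
  by_cases hm : D.d < mm
  · rw [(u : model D.π.W D.d).2 l mm (Or.inr hm), Submodule.coe_zero]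
    change ‖(0 : ℂ)‖ ≤ _
    rw [norm_zero]
    exact mul_nonneg (Finset.sum_nonneg fun p _ => hA0 p) (pow_nonneg (by positivity) _)
  have hp : (l, mm) ∈ S := by
    rw [hS, Finset.mem_product, Finset.mem_range, Finset.mem_range]; omega
  calc ‖(((u : ℕ → ℕ → D.π.W) l mm : D.π.W) : (AdelicGroupData.gl 2 K).Adelic → ℂ) (pt K (toGL M) c)‖
      ≤ A (l, mm) * (1 + ‖M‖ + ‖M⁻¹‖) ^ r (l, mm) := hA (l, mm) M hM
    _ ≤ A (l, mm) * (1 + ‖M‖ + ‖M⁻¹‖) ^ S.sup r :=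
        mul_le_mul_of_nonneg_left (pow_le_pow_right₀ hs1 (Finset.le_sup hp)) (hA0 _)
    _ ≤ (∑ p ∈ S, A p) * (1 + ‖M‖ + ‖M⁻¹‖) ^ S.sup r :=
        mul_le_mul_of_nonneg_right (Finset.single_le_sum (fun p _ => hA0 p) hp) (pow_nonneg (by positivity) _)

/-- **`‖Θ(η(X)(pt M c))‖ = O(s(M)^r)`.** [folklore] -/
theorem exists_bound_vec (X : Mat) :
    ∃ r : ℕ, ∀ c : BigHeckeGLn.FiniteAdelicGL 2 K, ∃ A : ℝ, 0 ≤ A ∧ ∀ M ∈ GL2C.Inv,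
      ‖D.vec X (pt K (toGL M) c)‖ ≤ A * (1 + ‖M‖ + ‖M⁻¹‖) ^ r := by
  obtain ⟨r, hr⟩ := D.exists_bound_entries (D.ηX X)
  refine ⟨r, fun c => ?_⟩
  obtain ⟨A, hA0, hA⟩ := hr c
  set S : Finset (ℕ × ℕ) := Finset.range (D.d + 1) ×ˢ Finset.range (D.d + 1) with hS
  refine ⟨A * ∑ p ∈ S, ‖D.Θ (Ops.single D.d p.1 p.2)‖, mul_nonneg hA0 (Finset.sum_nonneg fun _ _ => norm_nonneg _),
    fun M hM => ?_⟩
  rw [vec, theta_mapModel_evalW, ← Finset.sum_product']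
  calc ‖∑ p ∈ S, (((D.ηX X : ℕ → ℕ → D.π.W) p.1 p.2 : D.π.W) : (AdelicGroupData.gl 2 K).Adelic → ℂ) (pt K (toGL M) c) •
        D.Θ (Ops.single D.d p.1 p.2)‖
      ≤ ∑ p ∈ S, A * (1 + ‖M‖ + ‖M⁻¹‖) ^ r * ‖D.Θ (Ops.single D.d p.1 p.2)‖ :=
        norm_sum_le_of_le _ fun p _ => by
          rw [_root_.norm_smul]
          exact mul_le_mul_of_nonneg_right (hA M hM p.1 p.2) (norm_nonneg _)
    _ = A * (∑ p ∈ S, ‖D.Θ (Ops.single D.d p.1 p.2)‖) * (1 + ‖M‖ + ‖M⁻¹‖) ^ r := by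
        rw [Finset.mul_sum, Finset.sum_mul]
        refine Finset.sum_congr rfl fun p _ => by ring

/-- **Polynomial growth of the family**: `‖family c (X_v) M'‖ ≤ B_c ‖v‖ s(M')^k` with one exponent.
[cite: BorelWallach2000, VII §2.2 and XIV 2.3] -/
theorem exists_family_bound (h2 : Module.finrank ℚ K = 2) :
    ∃ k : ℕ, ∀ c : BigHeckeGLn.FiniteAdelicGL 2 K, ∃ B : ℝ, 0 ≤ B ∧ ∀ (v : ℂ × ℝ) (M' : Mat), M' ∈ GL2C.Inv →
      ‖D.family c (Xof v) M'‖ ≤ B * ‖v‖ * (1 + ‖M'‖ + ‖M'⁻¹‖) ^ k := by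
  have hK : Subsingleton (InfinitePlace K) := subsingleton_infinitePlace K h2
  obtain ⟨CE, kE, hCE, HE⟩ := exists_norm_coeffRepC_le K D.lam hK
  obtain ⟨r₁, h₁⟩ := D.exists_bound_vec (Xof ((1 : ℂ), (0 : ℝ)))
  obtain ⟨r₂, h₂⟩ := D.exists_bound_vec (Xof ((I : ℂ), (0 : ℝ)))
  obtain ⟨r₃, h₃⟩ := D.exists_bound_vec (Xof ((0 : ℂ), (1 : ℝ)))
  refine ⟨kE + max r₁ (max r₂ r₃), fun c => ?_⟩
  obtain ⟨A₁, hA₁, H₁⟩ := h₁ c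
  obtain ⟨A₂, hA₂, H₂⟩ := h₂ c
  obtain ⟨A₃, hA₃, H₃⟩ := h₃ c
  set B := CE * (A₁ + A₂ + A₃) with hB
  have hB0 : 0 ≤ B := mul_nonneg hCE (by positivity)
  -- the three basis values
  have key : ∀ {X : Mat} {A : ℝ} {r : ℕ}, 0 ≤ A → A ≤ A₁ + A₂ + A₃ → r ≤ max r₁ (max r₂ r₃) →
      (∀ M ∈ GL2C.Inv, ‖D.vec X (pt K (toGL M) c)‖ ≤ A * (1 + ‖M‖ + ‖M⁻¹‖) ^ r) →
      ∀ M' ∈ GL2C.Inv, ‖D.family c X M'‖ ≤ B * (1 + ‖M'‖ + ‖M'⁻¹‖) ^ (kE + max r₁ (max r₂ r₃)) := by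
    intro X A r hA0 hAle hrle hX M' hM'
    have hs1 := one_le_size M'
    rw [family_apply]
    calc ‖coeffRepC K D.lam (toGL M') (D.vec X (pt K (toGL M') c))‖
        ≤ CE * (1 + ‖M'‖ + ‖M'⁻¹‖) ^ kE * ‖D.vec X (pt K (toGL M') c)‖ := HE M' hM' _
      _ ≤ CE * (1 + ‖M'‖ + ‖M'⁻¹‖) ^ kE * (A * (1 + ‖M'‖ + ‖M'⁻¹‖) ^ r) :=
          mul_le_mul_of_nonneg_left (hX M' hM') (mul_nonneg hCE (pow_nonneg (by positivity) _))
      _ ≤ CE * (1 + ‖M'‖ + ‖M'⁻¹‖) ^ kE * ((A₁ + A₂ + A₃) * (1 + ‖M'‖ + ‖M'⁻¹‖) ^ max r₁ (max r₂ r₃)) :=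
          mul_le_mul_of_nonneg_left (mul_le_mul hAle (pow_le_pow_right₀ hs1 hrle) (pow_nonneg (by positivity) _)
            (by positivity)) (mul_nonneg hCE (pow_nonneg (by positivity) _))
      _ = B * (1 + ‖M'‖ + ‖M'⁻¹‖) ^ (kE + max r₁ (max r₂ r₃)) := by rw [hB, pow_add]; ring
  refine ⟨3 * B, by positivity, fun v M' hM' => ?_⟩
  have := cochain_bound_of_basis (f := D.family c) (B := B) (k := kE + max r₁ (max r₂ r₃))
    (key hA₁ (by linarith) (le_max_left _ _) H₁)
    (key hA₂ (by linarith) ((le_max_left _ _).trans (le_max_right _ _)) H₂)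
    (key hA₃ (by linarith) ((le_max_right _ _).trans (le_max_right _ _)) H₃) v hM'
  linarith [this]

/-- **Growth of `Ψ`**: `‖Ψ(pt g c)‖ ≤ a(cL) s(g)^r`. [cite: BorelWallach2000, VII §2.2 and XIV 2.3] -/
theorem exists_norm_Psi_le (h2 : Module.finrank ℚ K = 2)
    (m : BigHeckeGLn.FiniteAdelicGL 2 K ⧸ ResGLnCohomology.level 2 K D.𝔫 → ResGLnCohomology.CoeffModule ℂ 2 K D.lam) :
    ∃ (r : ℕ) (a : BigHeckeGLn.FiniteAdelicGL 2 K ⧸ ResGLnCohomology.level 2 K D.𝔫 → ℝ), (∀ q, 0 ≤ a q) ∧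
      ∀ (g : GL (Fin 2) ℂ) (c : BigHeckeGLn.FiniteAdelicGL 2 K),
        ‖D.Psi m (pt K g c)‖ ≤ a (QuotientGroup.mk c) * (1 + ‖(g : Mat)‖ + ‖(g : Mat)⁻¹‖) ^ r := by
  have hK : Subsingleton (InfinitePlace K) := subsingleton_infinitePlace K h2
  obtain ⟨k, hk⟩ := D.exists_family_bound h2
  obtain ⟨Ci, ki, hCi, HCi⟩ := exists_norm_coeffRepC_inv_le K D.lam hK
  have hB : ∀ q : BigHeckeGLn.FiniteAdelicGL 2 K ⧸ ResGLnCohomology.level 2 K D.𝔫, ∃ B : ℝ, 0 ≤ B ∧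
      ∀ (v : ℂ × ℝ) (M' : Mat), M' ∈ GL2C.Inv → ‖D.family q.out (Xof v) M'‖ ≤ B * ‖v‖ * (1 + ‖M'‖ + ‖M'⁻¹‖) ^ k :=
    fun q => hk q.out
  choose B hB0 hB using hB
  refine ⟨ki + (8 * k + 8), fun q => Ci * (2 * 13 ^ k * 4 ^ (2 * k + 2) * B q + ‖m q‖), fun q => by
    have := hB0 q; positivity, fun g c => ?_⟩
  set q : BigHeckeGLn.FiniteAdelicGL 2 K ⧸ ResGLnCohomology.level 2 K D.𝔫 := QuotientGroup.mk c with hq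
  have hg : ((g : Mat)) ∈ GL2C.Inv := isUnit_det_coe g
  have hs1 := one_le_size (g : Mat)
  have hPsi : D.Psi m (pt K g c) = coeffRepC K D.lam (toGL (g : Mat))⁻¹ (GL2C.primitive (D.family q.out) (g : Mat) - m q) := by
    rw [Psi, toComplexGL_pt, sndHom_pt, prim, toGL_coe]
  have hprim : ‖GL2C.primitive (D.family q.out) (g : Mat)‖ ≤
      2 * 13 ^ k * 4 ^ (2 * k + 2) * B q * (1 + ‖(g : Mat)‖ + ‖(g : Mat)⁻¹‖) ^ (8 * k + 8) :=
    norm_primitive_le (hB0 q) (hB q) hg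
  rw [hPsi]
  calc ‖coeffRepC K D.lam (toGL (g : Mat))⁻¹ (GL2C.primitive (D.family q.out) (g : Mat) - m q)‖
      ≤ Ci * (1 + ‖(g : Mat)‖ + ‖(g : Mat)⁻¹‖) ^ ki * ‖GL2C.primitive (D.family q.out) (g : Mat) - m q‖ := HCi _ hg _
    _ ≤ Ci * (1 + ‖(g : Mat)‖ + ‖(g : Mat)⁻¹‖) ^ ki *
          ((2 * 13 ^ k * 4 ^ (2 * k + 2) * B q + ‖m q‖) * (1 + ‖(g : Mat)‖ + ‖(g : Mat)⁻¹‖) ^ (8 * k + 8)) := by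
        refine mul_le_mul_of_nonneg_left ?_ (mul_nonneg hCi (pow_nonneg (by positivity) _))
        calc ‖GL2C.primitive (D.family q.out) (g : Mat) - m q‖
            ≤ ‖GL2C.primitive (D.family q.out) (g : Mat)‖ + ‖m q‖ := norm_sub_le _ _
          _ ≤ 2 * 13 ^ k * 4 ^ (2 * k + 2) * B q * (1 + ‖(g : Mat)‖ + ‖(g : Mat)⁻¹‖) ^ (8 * k + 8) +
                ‖m q‖ * (1 + ‖(g : Mat)‖ + ‖(g : Mat)⁻¹‖) ^ (8 * k + 8) :=
              add_le_add hprim (le_mul_of_one_le_right (norm_nonneg _) (one_le_pow₀ hs1))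
          _ = _ := by ring
    _ = Ci * (2 * 13 ^ k * 4 ^ (2 * k + 2) * B q + ‖m q‖) * (1 + ‖(g : Mat)‖ + ‖(g : Mat)⁻¹‖) ^ (ki + (8 * k + 8)) := by
        rw [pow_add]; ring

/-! ### The twist factor `|χ(det x)| = |det x|_𝔸^{Re s}` has polynomial growth -/

omit [IsTotallyComplex K] in
/-- For `N, N⁻¹ ≤ b` with `b ≥ 1`: `N^t ≤ b^{⌈|t|⌉}` (real powers). [folklore] -/
theorem rpow_le_pow_natCeil_abs {N b t : ℝ} (hN : 0 < N) (hb : 1 ≤ b) (h1 : N ≤ b) (h2 : N⁻¹ ≤ b) :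
    N ^ t ≤ b ^ ⌈|t|⌉₊ := by
  have hb0 : 0 ≤ b := zero_le_one.trans hb
  have key : N ^ t ≤ b ^ |t| := by
    rcases le_or_gt 0 t with ht | ht
    · rw [abs_of_nonneg ht]
      exact Real.rpow_le_rpow hN.le h1 ht
    · rw [abs_of_neg ht, show N ^ t = N⁻¹ ^ (-t) by rw [Real.inv_rpow hN.le, Real.rpow_neg hN.le, inv_inv]]
      exact Real.rpow_le_rpow (inv_nonneg.2 hN.le) h2 (by linarith)
  refine key.trans ?_
  rw [← Real.rpow_natCast]
  exact Real.rpow_le_rpow_of_exponent_le hb (Nat.le_ceil _)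

omit [IsTotallyComplex K] in
/-- **`|χ(det x)| ≤ C₀ (1 ⊔ ‖x‖)^k` for `χ = |·|_𝔸^s`** (`|det x|_𝔸^{±1} ≤ (n!)^{[K:ℚ]} (1 ⊔ ‖x‖)^{n[K:ℚ]}`,
`ideleNorm_det_le_height`, `adelicHeightGL_inv`). [cite: BorelJacquetCorvallis1979, §1.2] -/
theorem exists_norm_detTwist_le {χ : HeckeCharacter K} {s : ℂ}
    (hχ : ∀ x : ideleGroup K, ((χ x : ℂˣ) : ℂ) = (GaloisRepresentations.ideleNorm x : ℂ) ^ s) :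
    ∃ (C₀ : ℝ) (k : ℕ), 0 ≤ C₀ ∧ ∀ x : GL (Fin 2) (AdeleRing (𝓞 K) K),
      ‖((detTwist 2 χ x : ℂˣ) : ℂ)‖ ≤ C₀ * (1 ⊔ adelicHeightGL 2 K x) ^ k := by
  set c : ℝ := ((2 : ℕ).factorial : ℝ) ^ Module.finrank ℚ K with hc
  set e : ℕ := 2 * Module.finrank ℚ K with he
  have hc1 : 1 ≤ c := by rw [hc]; exact one_le_pow₀ (by norm_num)
  refine ⟨c ^ ⌈|s.re|⌉₊, e * ⌈|s.re|⌉₊, by positivity, fun x => ?_⟩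
  set U : ℝ := 1 ⊔ adelicHeightGL 2 K x with hU
  have hU1 : 1 ≤ U := le_sup_left
  set N : ℝ := GaloisRepresentations.ideleNorm (Matrix.GeneralLinearGroup.det x) with hN
  have hNpos : 0 < N := by
    rw [hN, ← coe_ideleNorm]
    exact NNReal.coe_pos.2 (pos_iff_ne_zero.2 (ideleNorm_ne_zero _))
  have hNle : N ≤ c * U ^ e := ideleNorm_det_le_height x
  have hNinv : N⁻¹ ≤ c * U ^ e := by
    have h := ideleNorm_det_le_height (n := 2) (K := K) x⁻¹
    rw [adelicHeightGL_inv, map_inv, ← coe_ideleNorm, map_inv, NNReal.coe_inv, coe_ideleNorm] at h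
    exact h
  have hb : 1 ≤ c * U ^ e := one_le_mul_of_one_le_of_one_le hc1 (one_le_pow₀ hU1)
  rw [detTwist_apply, hχ, Complex.norm_cpow_eq_rpow_re_of_pos hNpos]
  calc N ^ s.re ≤ (c * U ^ e) ^ ⌈|s.re|⌉₊ := rpow_le_pow_natCeil_abs hNpos hb hNle hNinv
    _ = c ^ ⌈|s.re|⌉₊ * U ^ (e * ⌈|s.re|⌉₊) := by rw [mul_pow, ← pow_mul U e]

/-! ### From coset-wise polynomial bounds to moderate growth in the archimedean variable -/

/-- **Conversion**: a bound `‖Φ(pt g c)‖ ≤ a(cL) s(g)^r (1 ⊔ ‖pt g c‖)^k` with `L` open gives, for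
every compact set `C` of finite components, `‖Φ x‖ ≤ A (1 ⊔ H_∞(x))^{r+k}` whenever `x_f ∈ C`
(finitely many cosets meet `C`; `s(g) ≤ 5(1 ⊔ H_∞)`; `∏_v H_v` is bounded on `C`).
[cite: BorelJacquetCorvallis1979, §1.2] -/
theorem archModerateGrowth_of_coset_bound (h2 : Module.finrank ℚ K = 2)
    {L : Subgroup (BigHeckeGLn.FiniteAdelicGL 2 K)} (hL : IsOpen (L : Set (BigHeckeGLn.FiniteAdelicGL 2 K)))
    {Φ : GL (Fin 2) (AdeleRing (𝓞 K) K) → ℂ} (a : BigHeckeGLn.FiniteAdelicGL 2 K ⧸ L → ℝ) (r k : ℕ)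
    (hΦ : ∀ (g : GL (Fin 2) ℂ) (c : BigHeckeGLn.FiniteAdelicGL 2 K),
      ‖Φ (pt K g c)‖ ≤ a (QuotientGroup.mk c) * (1 + ‖(g : Mat)‖ + ‖(g : Mat)⁻¹‖) ^ r * (1 ⊔ adelicHeightGL 2 K (pt K g c)) ^ k)
    (C : Set (BigHeckeGLn.FiniteAdelicGL 2 K)) (hC : IsCompact C) :
    ∃ (A : ℝ) (r' : ℕ), ∀ x : GL (Fin 2) (AdeleRing (𝓞 K) K), GLn.sndHom 2 K x ∈ C →
      ‖Φ x‖ ≤ A * (1 ⊔ (GLn.archHeight 2 K x : ℝ)) ^ r' := by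
  haveI : DiscreteTopology (BigHeckeGLn.FiniteAdelicGL 2 K ⧸ L) := QuotientGroup.discreteTopology hL
  -- `a` is bounded on the finitely many cosets meeting `C`
  have hfin : ((QuotientGroup.mk : _ → BigHeckeGLn.FiniteAdelicGL 2 K ⧸ L) '' C).Finite :=
    (hC.image (QuotientGroup.continuous_mk (N := L))).finite_of_discrete
  obtain ⟨A₀, hA₀⟩ := (hfin.image a).bddAbove
  -- `∏_v H_v` is bounded on `C`
  obtain ⟨B, hB⟩ := hC.bddAbove_image (continuous_finHeight (K := K)).continuousOn
  set B' := max B 1 with hB'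
  have hB'1 : 1 ≤ B' := le_max_right _ _
  refine ⟨max A₀ 0 * 5 ^ r * B' ^ k, r + k, fun x hx => ?_⟩
  set g := toComplexGL K 2 x with hg
  set c := GLn.sndHom 2 K x with hc
  have hxe : pt K g c = x := pt_toComplexGL_sndHom K h2 x
  set H : ℝ := 1 ⊔ (GLn.archHeight 2 K x : ℝ) with hH
  have hH1 : 1 ≤ H := le_sup_left
  have hH0 : 0 ≤ H := zero_le_one.trans hH1
  have ha : a (QuotientGroup.mk c) ≤ max A₀ 0 :=
    (hA₀ (Set.mem_image_of_mem a (Set.mem_image_of_mem _ hx))).trans (le_max_left _ _)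
  have hs : 1 + ‖(g : Mat)‖ + ‖(g : Mat)⁻¹‖ ≤ 5 * H := by
    have := size_le_five_mul_archHeight_pt K g c
    rwa [hxe] at this
  have hs0 : 0 ≤ 1 + ‖(g : Mat)‖ + ‖(g : Mat)⁻¹‖ := zero_le_one.trans (one_le_size _)
  have hP : finHeight (K := K) c ≤ B' := (hB (Set.mem_image_of_mem _ hx)).trans (le_max_left _ _)
  have hadel : 1 ⊔ adelicHeightGL 2 K (pt K g c) ≤ B' * H := by
    rw [adelicHeightGL_pt, hxe]
    refine sup_le ?_ ?_
    · nlinarith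
    · calc (GLn.archHeight 2 K x : ℝ) * finHeight (K := K) c ≤ H * B' :=
            mul_le_mul le_sup_right hP (zero_le_one.trans (one_le_finHeight c)) hH0
        _ = B' * H := mul_comm _ _
  have h0 : 0 ≤ 1 ⊔ adelicHeightGL 2 K (pt K g c) := zero_le_one.trans le_sup_left
  rw [← hxe]
  calc ‖Φ (pt K g c)‖ ≤ a (QuotientGroup.mk c) * (1 + ‖(g : Mat)‖ + ‖(g : Mat)⁻¹‖) ^ r * (1 ⊔ adelicHeightGL 2 K (pt K g c)) ^ k :=
        hΦ g c
    _ ≤ max A₀ 0 * (5 * H) ^ r * (B' * H) ^ k := by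
        refine mul_le_mul (mul_le_mul ha (pow_le_pow_left₀ hs0 hs r) (pow_nonneg hs0 _) (le_max_right _ _))
          (pow_le_pow_left₀ h0 hadel k) (pow_nonneg h0 _) ?_
        exact mul_nonneg (le_max_right _ _) (pow_nonneg (by positivity) _)
    _ = max A₀ 0 * 5 ^ r * B' ^ k * H ^ (r + k) := by rw [mul_pow, mul_pow, pow_add]; ring

/-- The level `K_f(𝔫)` is open. [folklore] -/
theorem isOpen_level : IsOpen ((ResGLnCohomology.level 2 K D.𝔫 : Subgroup (BigHeckeGLn.FiniteAdelicGL 2 K)) :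
    Set (BigHeckeGLn.FiniteAdelicGL 2 K)) :=
  Subgroup.isOpen_of_mem_nhds _ (finitePrincipalCongruenceLevel_mem_nhds_one (n := 2) (K := K) D.h𝔫)

/-- **The twisted coordinates of `Ψ` have moderate growth in the archimedean variable, locally
uniformly in the finite variable.** [cite: BorelWallach2000, VII §2.2 and XIV 2.3] -/
theorem coordFun_twist_archModerateGrowth (h2 : Module.finrank ℚ K = 2)
    (m : BigHeckeGLn.FiniteAdelicGL 2 K ⧸ ResGLnCohomology.level 2 K D.𝔫 → ResGLnCohomology.CoeffModule ℂ 2 K D.lam)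
    {χ : HeckeCharacter K} {s : ℂ}
    (hχ : ∀ x : ideleGroup K, ((χ x : ℂˣ) : ℂ) = (GaloisRepresentations.ideleNorm x : ℂ) ^ s) (l mm : ℕ)
    (C : Set (BigHeckeGLn.FiniteAdelicGL 2 K)) (hC : IsCompact C) :
    ∃ (A : ℝ) (r : ℕ), ∀ x : GL (Fin 2) (AdeleRing (𝓞 K) K), GLn.sndHom 2 K x ∈ C →
      ‖mulChar (detTwist 2 χ) (D.coordFun m l mm) x‖ ≤ A * (1 ⊔ (GLn.archHeight 2 K x : ℝ)) ^ r := by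
  obtain ⟨r, a, ha0, hΨ⟩ := D.exists_norm_Psi_le h2 m
  obtain ⟨C₀, k, hC₀, hdet⟩ := exists_norm_detTwist_le (K := K) hχ
  set Lℝ := LinearMap.toContinuousLinearMap ((D.coordLM l mm).restrictScalars ℝ) with hLℝ
  refine archModerateGrowth_of_coset_bound h2 D.isOpen_level (Φ := mulChar (detTwist 2 χ) (D.coordFun m l mm))
    (fun q => C₀ * ‖Lℝ‖ * a q) r k (fun g c => ?_) C hC
  rw [mulChar_apply, norm_mul, coordFun_eq]
  change ‖((detTwist 2 χ (pt K g c) : ℂˣ) : ℂ)‖ * ‖Lℝ (D.Psi m (pt K g c))‖ ≤ _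
  have h1 := hdet (pt K g c)
  have h2' := Lℝ.le_opNorm (D.Psi m (pt K g c))
  have h3 := hΨ g c
  have h0 : 0 ≤ 1 ⊔ adelicHeightGL 2 K (pt K g c) := zero_le_one.trans le_sup_left
  calc ‖((detTwist 2 χ (pt K g c) : ℂˣ) : ℂ)‖ * ‖Lℝ (D.Psi m (pt K g c))‖
      ≤ (C₀ * (1 ⊔ adelicHeightGL 2 K (pt K g c)) ^ k) * (‖Lℝ‖ * (a (QuotientGroup.mk c) * (1 + ‖(g : Mat)‖ + ‖(g : Mat)⁻¹‖) ^ r)) :=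
        mul_le_mul h1 (h2'.trans (mul_le_mul_of_nonneg_left h3 (norm_nonneg _))) (norm_nonneg _)
          (mul_nonneg hC₀ (pow_nonneg h0 _))
    _ = C₀ * ‖Lℝ‖ * a (QuotientGroup.mk c) * (1 + ‖(g : Mat)‖ + ‖(g : Mat)⁻¹‖) ^ r * (1 ⊔ adelicHeightGL 2 K (pt K g c)) ^ k := by
        ring

/-! ### The derivative of `Ψ` along `𝔭` -/

omit [IsTotallyComplex K] in
/-- **Derivative of the primitive along `M exp(tX)`, `X ∈ 𝔭`: `f(X)(M)`.** [cite: BorelWallach2000, VII §2.2] -/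
theorem hasDerivAt_primitive_mul_exp {V : Type*} [NormedAddCommGroup V] [NormedSpace ℝ V] [CompleteSpace V]
    {f : Mat →ₗ[ℝ] Mat → V} (hf : GL2C.IsCochain f) {M : Mat} (hM : M ∈ GL2C.Inv) {X : Mat} (hX : IsHT X) :
    HasDerivAt (fun t : ℝ => GL2C.primitive f (M * NormedSpace.exp (t • X))) (f X M) 0 := by
  have hkd : HasDerivAt (fun t : ℝ => NormedSpace.exp (t • X)) X 0 := hasDerivAt_exp_smul_zero X
  have hA : HasDerivAt (fun t : ℝ => GL2C.primitive f (M * NormedSpace.exp (t • X))) (fderiv ℝ (GL2C.primitive f) M (M * X)) 0 :=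
    (hasFDerivAt_primitive hf hM).differentiableAt.hasFDerivAt.comp_hasDerivAt_of_eq 0
      (hkd.const_mul M) (by simp)
  rwa [fderiv_primitive_mul hf hM hX] at hA

/-- **Leibniz rule for `t ↦ E(exp(tY)) v(t)` at `t = 0`**: derivative `v'(0) + dE(φ_{w₀} Y) v(0)`. [folklore] -/
theorem hasDerivAt_coeffRepC_expGL_apply (h2 : Module.finrank ℚ K = 2) {lam : (K →+* ℂ) → Fin 2 → ℤ} (Y : Mat)
    {v : ℝ → ResGLnCohomology.CoeffModule ℂ 2 K lam} {v' : ResGLnCohomology.CoeffModule ℂ 2 K lam} (hv : HasDerivAt v v' 0) :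
    HasDerivAt (fun t : ℝ => coeffRepC K lam (expGL (t • Y)) (v t)) (v' + coeffPlaceLie K lam (complexPlace K) Y (v 0)) 0 := by
  have hK : Subsingleton (InfinitePlace K) := subsingleton_infinitePlace K h2
  set b := Module.finBasis ℂ (ResGLnCohomology.CoeffModule ℂ 2 K lam) with hb
  have hfun : (fun t : ℝ => coeffRepC K lam (expGL (t • Y)) (v t)) =
      fun t => ∑ i, b.coord i (v t) • coeffRepC K lam (expGL (t • Y)) (b i) := by
    funext t
    conv_lhs => rw [← b.sum_repr (v t)]
    rw [map_sum]; simp only [map_smul]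
    rfl
  rw [hfun]
  have hterm : ∀ i, HasDerivAt (fun t : ℝ => b.coord i (v t) • coeffRepC K lam (expGL (t • Y)) (b i))
      (b.coord i (v 0) • coeffPlaceLie K lam (complexPlace K) Y (b i) + b.coord i v' • b i) 0 := by
    intro i
    have hc : HasDerivAt (fun t : ℝ => b.coord i (v t)) (b.coord i v') 0 :=
      (LinearMap.toContinuousLinearMap ((b.coord i).restrictScalars ℝ)).hasFDerivAt.comp_hasDerivAt 0 hv
    have he := hasDerivAt_coeffRepC_expGL K lam hK Y (b i)
    have h := hc.smul he
    rwa [zero_smul, expGL_zero, map_one, Module.End.one_apply] at h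
  refine (HasDerivAt.fun_sum fun i _ => hterm i).congr_deriv ?_
  rw [Finset.sum_add_distrib, add_comm]
  congr 1
  · conv_rhs => rw [← b.sum_repr v']
    rfl
  · conv_rhs => rw [← b.sum_repr (v 0), map_sum]
    simp only [map_smul]
    rfl

/-- `Ψ` along `g exp(tX)` in product form. [folklore] -/
theorem Psi_pt_mul_expGL (m : BigHeckeGLn.FiniteAdelicGL 2 K ⧸ ResGLnCohomology.level 2 K D.𝔫 → ResGLnCohomology.CoeffModule ℂ 2 K D.lam)
    (g : GL (Fin 2) ℂ) (c : BigHeckeGLn.FiniteAdelicGL 2 K) (X : Mat) (t : ℝ) :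
    D.Psi m (pt K (g * expGL (t • X)) c) = coeffRepC K D.lam (expGL (t • (-X)))
      (coeffRepC K D.lam g⁻¹ (GL2C.primitive (D.family
        (QuotientGroup.mk c : BigHeckeGLn.FiniteAdelicGL 2 K ⧸ ResGLnCohomology.level 2 K D.𝔫).out)
          ((g : Mat) * NormedSpace.exp (t • X)) - m (QuotientGroup.mk c))) := by
  rw [Psi, toComplexGL_pt, sndHom_pt, prim, _root_.mul_inv_rev, map_mul, Module.End.mul_apply, smul_neg, expGL_neg,
    Units.val_mul, coe_expGL]

/-- **The derivative of `Ψ` along `g exp(tX)`, `X ∈ 𝔭`**: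
`Θ(η(X)(pt g c)) − dE(φ_{w₀} X) Ψ(pt g c)` — the closed `E`-valued form `ω = dF` read back through
`Ψ = E(g⁻¹)(F − m)`. [cite: Harder1987, §3.1] [cite: BorelWallach2000, VII §2.2] -/
theorem hasDerivAt_Psi_pt_mul_expGL (h2 : Module.finrank ℚ K = 2)
    (m : BigHeckeGLn.FiniteAdelicGL 2 K ⧸ ResGLnCohomology.level 2 K D.𝔫 → ResGLnCohomology.CoeffModule ℂ 2 K D.lam)
    (g : GL (Fin 2) ℂ) (c : BigHeckeGLn.FiniteAdelicGL 2 K) {X : Mat} (hX : IsHT X) :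
    HasDerivAt (fun t : ℝ => D.Psi m (pt K (g * expGL (t • X)) c))
      (D.vec X (pt K g c) - coeffPlaceLie K D.lam (complexPlace K) X (D.Psi m (pt K g c))) 0 := by
  have hK : Subsingleton (InfinitePlace K) := subsingleton_infinitePlace K h2
  set q : BigHeckeGLn.FiniteAdelicGL 2 K ⧸ ResGLnCohomology.level 2 K D.𝔫 := QuotientGroup.mk c with hq
  have hg : (g : Mat) ∈ GL2C.Inv := isUnit_det_coe g
  -- the inner function `v(t) = E(g⁻¹)(F(g exp tX) − m q)` and its derivative `Θ(η(X)(pt g c))`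
  set v : ℝ → ResGLnCohomology.CoeffModule ℂ 2 K D.lam := fun t =>
    coeffRepC K D.lam g⁻¹ (GL2C.primitive (D.family q.out) ((g : Mat) * NormedSpace.exp (t • X)) - m q) with hv_def
  have hP : HasDerivAt (fun t : ℝ => GL2C.primitive (D.family q.out) ((g : Mat) * NormedSpace.exp (t • X)) - m q)
      (D.family q.out X (g : Mat)) 0 :=
    (hasDerivAt_primitive_mul_exp (D.isCochain_family h2 _) hg hX).sub_const _
  have hv : HasDerivAt v (D.vec X (pt K g c)) 0 := by
    have h := (LinearMap.toContinuousLinearMap ((coeffRepC K D.lam g⁻¹).restrictScalars ℝ)).hasFDerivAt.comp_hasDerivAt 0 hP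
    refine h.congr_deriv ?_
    change coeffRepC K D.lam g⁻¹ (D.family q.out X (g : Mat)) = _
    rw [show D.family q.out = D.family c from (D.isAutomorphicFamily h2).apply_out c, family_apply, toGL_coe,
      ← Module.End.mul_apply, ← map_mul, inv_mul_cancel, map_one, Module.End.one_apply]
  have hmain := hasDerivAt_coeffRepC_expGL_apply h2 (-X) hv
  have hfun : (fun t : ℝ => D.Psi m (pt K (g * expGL (t • X)) c)) = fun t => coeffRepC K D.lam (expGL (t • (-X))) (v t) :=
    funext fun t => D.Psi_pt_mul_expGL m g c X t
  rw [hfun]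
  refine hmain.congr_deriv ?_
  have hv0 : v 0 = D.Psi m (pt K g c) := by
    have h1 : NormedSpace.exp ((0 : ℝ) • X) = 1 := by rw [zero_smul]; exact NormedSpace.exp_zero
    simp only [hv_def, h1, mul_one]
    rw [Psi, toComplexGL_pt, sndHom_pt, prim]
  rw [hv0, map_neg, LinearMap.neg_apply, ← sub_eq_add_neg]

/-- The `𝔭`-directions of the coefficient operators read in coordinates. [folklore] -/
theorem coordLM_coeffPlaceLie_Xmat (i : Fin 3) (l mm : ℕ) (u : ResGLnCohomology.CoeffModule ℂ 2 K D.lam) :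
    D.coordLM l mm (coeffPlaceLie K D.lam (complexPlace K) (Xmat i) u) =
      ((((coeff (C := ℂ) D.d).pVec i (D.Θ.symm u) : model ℂ D.d) : ℕ → ℕ → ℂ) l mm) := by
  conv_lhs => rw [← D.Θ.apply_symm_apply u, coeffPlaceLie_Xmat_theta]
  rw [coordLM_apply, LinearEquiv.symm_apply_apply]

/-- `Θ(η(x_i)(x))` read in coordinates is the entry of `η i` at `x`. [folklore] -/
theorem coordLM_vec_Xmat (i : Fin 3) (l mm : ℕ) (x : (AdelicGroupData.gl 2 K).Adelic) :
    D.coordLM l mm (D.vec (Xmat i) x) = (((D.η i : ℕ → ℕ → D.π.W) l mm : D.π.W) : (AdelicGroupData.gl 2 K).Adelic → ℂ) x := by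
  rw [vec, ηX_Xmat, coordLM_apply, LinearEquiv.symm_apply_apply, mapModel_apply, evalW_apply]

/-- **The Lie derivative of the coordinates of `Ψ` along `x_i ∈ 𝔭`**:
`X_i Ψ_{l,m} = (η_i)_{l,m} − ((dE ⊗ 1)(x_i) Θ⁻¹Ψ)_{l,m}`, i.e. `dΨ = η − ρ_E Ψ` on `𝔭`.
[cite: Harder1987, §3.1] [cite: BorelWallach2000, VII §2.2] -/
theorem lieDeriv_coordFun (h2 : Module.finrank ℚ K = 2)
    (m : BigHeckeGLn.FiniteAdelicGL 2 K ⧸ ResGLnCohomology.level 2 K D.𝔫 → ResGLnCohomology.CoeffModule ℂ 2 K D.lam)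
    (i : Fin 3) (l mm : ℕ) (x : (AdelicGroupData.gl 2 K).Adelic) :
    lieDeriv (AutomorphyDatum.gl 2 K hcpt).ofArch (placeLie 2 (complexPlace K) (Xmat i)) (D.coordFun m l mm) x =
      (((D.η i : ℕ → ℕ → D.π.W) l mm : D.π.W) : (AdelicGroupData.gl 2 K).Adelic → ℂ) x -
        ((((coeff (C := ℂ) D.d).pVec i (D.arr m x) : model ℂ D.d) : ℕ → ℕ → ℂ) l mm) := by
  have hK : Subsingleton (InfinitePlace K) := subsingleton_infinitePlace K h2
  set g := toComplexGL K 2 x with hg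
  set c := GLn.sndHom 2 K x with hc
  have hxe : pt K g c = x := pt_toComplexGL_sndHom K h2 x
  have hflow := hasDerivAt_pt_mul_expGL hK (D.isArchSmooth_coordFun h2 m l mm) g c (Xmat i)
  have hours : HasDerivAt (fun s : ℝ => D.coordFun m l mm (pt K (g * expGL (s • Xmat i)) c))
      (D.coordLM l mm (D.vec (Xmat i) (pt K g c) - coeffPlaceLie K D.lam (complexPlace K) (Xmat i) (D.Psi m (pt K g c)))) 0 :=
    (LinearMap.toContinuousLinearMap ((D.coordLM l mm).restrictScalars ℝ)).hasFDerivAt.comp_hasDerivAt 0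
      (D.hasDerivAt_Psi_pt_mul_expGL h2 m g c (isHT_Xmat i))
  have heq := hflow.unique hours
  rw [hxe] at heq
  rw [heq, map_sub, coordLM_coeffPlaceLie_Xmat, coordLM_vec_Xmat]
  rfl

end FamilyData

end GL2CESH

end Literature.NumberTheory.Automorphic

end
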